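import Summits.QuantumFields.YangMills.Theorems.BalabanLadderNTStrongCouplingLongTubeFamily
import Summits.QuantumFields.YangMills.Theorems.BalabanLadderNTStrongCouplingClosedFamilies
import HarnessLib

/-!
# Crux `NT` (stmt-QuantumFields-19353), strong-coupling rungs: the temporal tube of ANY length is SPHERE-LIKE

Helper file of the fleet lead prover of crux `NT` (unit `ym-spine-19353-p1`, g27), part II of the length-generic tube
toolkit (`…LongTubeDefs`, `…LongTubeFamily`).  The hypothesis `hsph` of `LongTube.pair_jet_of_class_conn` (hypothesis (H2)
of `Literature…StrongCouplingLeading.truncated_sub_leading_isBigO_multi_conn`): every proper non-empty sub-family of the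
tube has a private bond.  The tree proves it for the literal ten- and eighteen-face tubes by kernel computation
(`S28DistanceTwo.sphere_of_chain` + `decide`); here a structural proof for every length `n ≥ 1`:

* `sphere_of_reachable` — a SPHERE CRITERION: if every face of `X` is reachable from a root face through faces of `X`
  consecutively sharing a bond, and no bond lies on three distinct faces of `X`, then `X` is sphere-like (the cut face of a
  path leaving the sub-family owns the cut bond);
* `longTube_no_three` — no bond lies on three faces of the tube: a temporal bond lies on sides only, two sides of one
  orientation through it coincide (`apply_orient_of_temporal_mem`: the `(0,m)`-sides have `m`-coordinate `z m`); a transverse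
  bond `(w, m)` lies on a non-temporal face based at time `w 0` (at most one cap) or on `(w; 0,m)`, `(w - e₀; 0,m)`
  (`ClosedFamilies.cases_of_transverse_mem`), and not on all three (`not_cap_and_two_sides`: no side below the bottom / at the top);
* `reach_sides`, `reach_all` — every face hangs on the bottom cap: the bottom sides by the cap's bonds, each higher side by
  the far bond of the side below, the top cap by the far bond of a top side;
* **`longTube_sphere`**, `longTubes_sphere` — the tube(s) of every length `n ≥ 1` are sphere-like.

HONEST FRAMING: lattice combinatorics only; nothing about measures, `β`, NT or the gap. [folklore]
-/

/-! ## Part II — the tube of any length is SPHERE-LIKE (every proper non-empty sub-family has a private bond) -/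

namespace Summit.QuantumFields.YangMills.Cruxes.NT.StrongCouplingRung.LongTube

open Finset
open Literature.Probability.LatticeModels (Site)
open Literature.MathematicalPhysics.QuantumLattice (ZdEdge ZdPlaquette plaquetteEdges)
open Literature.MathematicalPhysics.QuantumFieldTheory (IsParallel mk_mem_plaquetteEdges_iff)

/-! ### A sphere criterion: reachability through shared bonds + «no bond on three faces» -/

/-- **Sphere criterion.**  If every face of `X` is reachable from a root face through faces of `X` consecutively sharing
a bond, and no bond lies on three distinct faces of `X`, then every proper non-empty sub-family of `X` has a private bond
(the cut face of a path leaving the sub-family owns the cut bond). [folklore] -/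
theorem sphere_of_reachable (X : Finset (ZdPlaquette 4)) {r : ZdPlaquette 4}
    (hreach : ∀ p ∈ X, Relation.ReflTransGen
      (fun p q : ZdPlaquette 4 => p ∈ X ∧ q ∈ X ∧ ∃ ℓ ∈ plaquetteEdges p, ℓ ∈ plaquetteEdges q) r p)
    (h3 : ∀ (ℓ : ZdEdge 4), ∀ p₁ ∈ X, ∀ p₂ ∈ X, ∀ p₃ ∈ X, ℓ ∈ plaquetteEdges p₁ → ℓ ∈ plaquetteEdges p₂ →
      ℓ ∈ plaquetteEdges p₃ → p₁ = p₂ ∨ p₁ = p₃ ∨ p₂ = p₃) :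
    ∀ S ⊆ X, S.Nonempty → S ≠ X →
      ∃ p ∈ S, ∃ ℓ ∈ plaquetteEdges p, ∀ p' ∈ S, p' ≠ p → ℓ ∉ plaquetteEdges p' := by
  intro S hSX hSne hSX'
  -- a cut pair: `p ∈ S`, `q ∈ X \ S` sharing a bond
  have hcut : ∃ p ∈ S, ∃ q ∈ X, q ∉ S ∧ ∃ ℓ ∈ plaquetteEdges p, ℓ ∈ plaquetteEdges q := by
    obtain ⟨q₀, hq₀X, hq₀S⟩ : ∃ q₀ ∈ X, q₀ ∉ S := by
      by_contra h
      push Not at h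
      exact hSX' (Subset.antisymm hSX h)
    obtain ⟨p₀, hp₀⟩ := hSne
    by_cases hr : r ∈ S
    · -- walk from `r ∈ S` to `q₀ ∉ S`
      have key : ∀ q, Relation.ReflTransGen
          (fun p q : ZdPlaquette 4 => p ∈ X ∧ q ∈ X ∧ ∃ ℓ ∈ plaquetteEdges p, ℓ ∈ plaquetteEdges q) r q →
          q ∈ S ∨ ∃ p ∈ S, ∃ q ∈ X, q ∉ S ∧ ∃ ℓ ∈ plaquetteEdges p, ℓ ∈ plaquetteEdges q := by
        intro q hq
        induction hq with
        | refl => exact Or.inl hr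
        | @tail b c _ hbc ih =>
          rcases ih with hb | h
          · by_cases hc : c ∈ S
            · exact Or.inl hc
            · exact Or.inr ⟨b, hb, c, hbc.2.1, hc, hbc.2.2⟩
          · exact Or.inr h
      rcases key q₀ (hreach q₀ hq₀X) with h | h
      · exact absurd h hq₀S
      · exact h
    · -- walk from `r ∉ S` to `p₀ ∈ S`
      have key : ∀ q, Relation.ReflTransGen
          (fun p q : ZdPlaquette 4 => p ∈ X ∧ q ∈ X ∧ ∃ ℓ ∈ plaquetteEdges p, ℓ ∈ plaquetteEdges q) r q →
          q ∉ S ∨ ∃ p ∈ S, ∃ q ∈ X, q ∉ S ∧ ∃ ℓ ∈ plaquetteEdges p, ℓ ∈ plaquetteEdges q := by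
        intro q hq
        induction hq with
        | refl => exact Or.inl hr
        | @tail b c _ hbc ih =>
          rcases ih with hb | h
          · by_cases hc : c ∈ S
            · obtain ⟨ℓ, hℓb, hℓc⟩ := hbc.2.2
              exact Or.inr ⟨c, hc, b, hbc.1, hb, ℓ, hℓc, hℓb⟩
            · exact Or.inl hc
          · exact Or.inr h
      rcases key p₀ (hreach p₀ (hSX hp₀)) with h | h
      · exact absurd hp₀ h
      · exact h
  obtain ⟨p, hpS, q, hqX, hqS, ℓ, hℓp, hℓq⟩ := hcut
  refine ⟨p, hpS, ℓ, hℓp, fun p' hp'S hp'p hℓp' => ?_⟩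
  have hpq : p ≠ q := fun h => hqS (h ▸ hpS)
  have hqp' : q ≠ p' := fun h => hqS (h ▸ hp'S)
  rcases h3 ℓ p (hSX hpS) q hqX p' (hSX hp'S) hℓp hℓq hℓp' with h | h | h
  · exact hpq h
  · exact hp'p h.symm
  · exact hqp' h

/-! ### Bonds of the faces of the tube -/

variable {z : Site 4} {n : ℕ} {a : {q : Fin 4 × Fin 4 // q.1 < q.2}} {ha : (0 : Fin 4) < a.1.1}

/-- A cap (non-temporal plaquette of orientation `a`, `0 < a₁`) contains no temporal bond. [folklore] -/
theorem not_temporal_mem_cap (x w : Site 4) (a : {q : Fin 4 × Fin 4 // q.1 < q.2}) (ha : (0 : Fin 4) < a.1.1) :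
    ((w, (0 : Fin 4)) : ZdEdge 4) ∉ plaquetteEdges ((x, a) : ZdPlaquette 4) := by
  rw [mk_mem_plaquetteEdges_iff]
  rintro (⟨h, -⟩ | ⟨h, -⟩)
  · exact absurd h (ne_of_gt ha)
  · exact absurd h (ne_of_gt (ha.trans a.2))

/-- **Transverse invariant of the sides.**  A temporal face `(y; 0, m)` of the tube has `y m = z m` (the `a₁`-sides sit
at `zₖ` or `zₖ + e_{a₂}`, the `a₂`-sides at `zₖ` or `zₖ + e_{a₁}`). [folklore] -/
theorem apply_orient_of_temporal_mem {p : ZdPlaquette 4} (hp : p ∈ longTube z n a ha) (hpar : p.2.1.1 = 0) :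
    p.1 p.2.1.2 = z p.2.1.2 := by
  have hne : a.1.1 ≠ 0 := (ne_of_lt ha).symm
  have h12 : a.1.1 ≠ a.1.2 := ne_of_lt a.2
  rw [mem_longTube] at hp
  rcases hp with rfl | rfl | ⟨k, -, hp⟩
  · exact absurd hpar hne
  · exact absurd hpar hne
  · rw [mem_tubeSides] at hp
    rcases hp with rfl | rfl | rfl | rfl
    · simp [Pi.single_eq_of_ne hne]
    · simp [Pi.single_eq_of_ne hne, Pi.single_eq_of_ne h12]
    · simp [Pi.single_eq_of_ne (ne_of_lt (ha.trans a.2)).symm]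
    · simp [Pi.single_eq_of_ne (ne_of_lt (ha.trans a.2)).symm, Pi.single_eq_of_ne h12.symm]

/-- Two temporal faces of the tube with the same orientation through one temporal bond coincide. [folklore] -/
theorem eq_of_temporal_bond {p p' : ZdPlaquette 4} (hp : p ∈ longTube z n a ha) (hp' : p' ∈ longTube z n a ha)
    {w : Site 4} (hw : ((w, (0 : Fin 4)) : ZdEdge 4) ∈ plaquetteEdges p)
    (hw' : ((w, (0 : Fin 4)) : ZdEdge 4) ∈ plaquetteEdges p') (ho : p.2 = p'.2) : p = p' := by
  obtain ⟨y, ⟨⟨j, m⟩, hjm⟩⟩ := p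
  obtain ⟨y', ⟨⟨j', m'⟩, hjm'⟩⟩ := p'
  simp only [Subtype.mk.injEq, Prod.mk.injEq] at ho
  obtain ⟨rfl, rfl⟩ := ho
  have hm0 : m ≠ 0 := (ne_of_lt (lt_of_le_of_lt (Fin.zero_le _) hjm)).symm
  rw [mk_mem_plaquetteEdges_iff] at hw hw'
  simp only at hw hw'
  rcases hw with ⟨hj, hwy⟩ | ⟨hm, -⟩
  swap
  · exact absurd hm hm0
  rcases hw' with ⟨-, hwy'⟩ | ⟨hm, -⟩
  swap
  · exact absurd hm hm0
  have hy := apply_orient_of_temporal_mem hp hj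
  have hy' := apply_orient_of_temporal_mem hp' hj
  simp only at hy hy'
  -- `y, y' ∈ {w, w - e_m}` with `y m = y' m`
  have hyy' : y = y' := by
    rcases hwy with rfl | rfl <;> rcases hwy' with h | h
    · exact h
    · have := congrFun h m
      rw [← hy'] at hy
      simp at this hy
      omega
    · have := congrFun h m
      rw [← hy'] at hy
      simp at this hy
      omega
    · exact add_right_cancel h
  subst hyy'
  rfl

/-- The non-temporal faces of the tube are the two caps, at distinct times (`n ≥ 1`); two non-temporal faces at the same
time coincide. [folklore] -/
theorem eq_of_nonTemporal_time {p p' : ZdPlaquette 4} (hp : p ∈ longTube z n a ha) (hp' : p' ∈ longTube z n a ha)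
    (hpar : p.2.1.1 ≠ 0) (hpar' : p'.2.1.1 ≠ 0) (ht : p.1 0 = p'.1 0) : p = p' := by
  rw [mem_longTube] at hp hp'
  rcases hp with rfl | rfl | ⟨k, -, hp⟩ <;> rcases hp' with rfl | rfl | ⟨k', -, hp'⟩
  · rfl
  · simp at ht
    simp [← ht]
  · exact absurd (time_of_mem_tubeSides hp').2 hpar'
  · simp at ht
    simp [ht]
  · rfl
  · exact absurd (time_of_mem_tubeSides hp').2 hpar'
  · exact absurd (time_of_mem_tubeSides hp).2 hpar
  · exact absurd (time_of_mem_tubeSides hp).2 hpar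
  · exact absurd (time_of_mem_tubeSides hp).2 hpar

/-- A cap at time `w 0` and both temporal plaquettes `(w; 0,m)`, `(w - e₀; 0,m)` cannot all be faces of the tube
(at the bottom there is no side below, at the top no side above). [folklore] -/
theorem not_cap_and_two_sides {p : ZdPlaquette 4} (hp : p ∈ longTube z n a ha) (hpar : p.2.1.1 ≠ 0) {w : Site 4}
    (ht : p.1 0 = w 0) {m : Fin 4} {hm : (0 : Fin 4) < m}
    (h₁ : ((w, ⟨(0, m), hm⟩) : ZdPlaquette 4) ∈ longTube z n a ha)
    (h₂ : ((w - Pi.single 0 1, ⟨(0, m), hm⟩) : ZdPlaquette 4) ∈ longTube z n a ha) : False := by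
  have hb₁ := time_bounds_of_mem_longTube h₁
  have hb₂ := time_bounds_of_mem_longTube h₂
  have h1 := hb₁.2.2 rfl
  have h2 := hb₂.1
  simp only [Pi.sub_apply, Pi.single_eq_same] at h2
  rw [mem_longTube] at hp
  rcases hp with rfl | rfl | ⟨k, -, hp⟩
  · simp only at ht
    omega
  · simp at ht
    simp only at h1
    omega
  · exact hpar (time_of_mem_tubeSides hp).2

/-- **No bond lies on three distinct faces of the tube.** [folklore] -/
theorem longTube_no_three {p₁ p₂ p₃ : ZdPlaquette 4} (h₁ : p₁ ∈ longTube z n a ha)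
    (h₂ : p₂ ∈ longTube z n a ha) (h₃ : p₃ ∈ longTube z n a ha) {ℓ : ZdEdge 4} (hl₁ : ℓ ∈ plaquetteEdges p₁)
    (hl₂ : ℓ ∈ plaquetteEdges p₂) (hl₃ : ℓ ∈ plaquetteEdges p₃) : p₁ = p₂ ∨ p₁ = p₃ ∨ p₂ = p₃ := by
  obtain ⟨w, μ⟩ := ℓ
  by_cases hμ : μ = 0
  · subst hμ
    -- temporal bond: the three faces are temporal, two share their orientation
    have orient : ∀ {p : ZdPlaquette 4}, p ∈ longTube z n a ha → ((w, (0 : Fin 4)) : ZdEdge 4) ∈ plaquetteEdges p →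
        p.2 = ⟨(0, a.1.1), ha⟩ ∨ p.2 = ⟨(0, a.1.2), ha.trans a.2⟩ := by
      intro p hp hw
      rw [mem_longTube] at hp
      rcases hp with rfl | rfl | ⟨k, -, hp⟩
      · exact absurd hw (not_temporal_mem_cap _ _ a ha)
      · exact absurd hw (not_temporal_mem_cap _ _ a ha)
      · rw [mem_tubeSides] at hp
        rcases hp with rfl | rfl | rfl | rfl
        · exact Or.inl rfl
        · exact Or.inl rfl
        · exact Or.inr rfl
        · exact Or.inr rfl
    rcases orient h₁ hl₁ with e₁ | e₁ <;> rcases orient h₂ hl₂ with e₂ | e₂ <;>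
      rcases orient h₃ hl₃ with e₃ | e₃
    · exact Or.inl (eq_of_temporal_bond h₁ h₂ hl₁ hl₂ (e₁.trans e₂.symm))
    · exact Or.inl (eq_of_temporal_bond h₁ h₂ hl₁ hl₂ (e₁.trans e₂.symm))
    · exact Or.inr (Or.inl (eq_of_temporal_bond h₁ h₃ hl₁ hl₃ (e₁.trans e₃.symm)))
    · exact Or.inr (Or.inr (eq_of_temporal_bond h₂ h₃ hl₂ hl₃ (e₂.trans e₃.symm)))
    · exact Or.inr (Or.inr (eq_of_temporal_bond h₂ h₃ hl₂ hl₃ (e₂.trans e₃.symm)))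
    · exact Or.inr (Or.inl (eq_of_temporal_bond h₁ h₃ hl₁ hl₃ (e₁.trans e₃.symm)))
    · exact Or.inl (eq_of_temporal_bond h₁ h₂ hl₁ hl₂ (e₁.trans e₂.symm))
    · exact Or.inl (eq_of_temporal_bond h₁ h₂ hl₁ hl₂ (e₁.trans e₂.symm))
  · -- transverse bond: a cap at time `w 0`, `(w; 0,μ)` or `(w - e₀; 0,μ)`
    have hμ' : (0 : Fin 4) < μ := Fin.pos_of_ne_zero hμ
    have classify : ∀ {p : ZdPlaquette 4}, p ∈ longTube z n a ha → ((w, μ) : ZdEdge 4) ∈ plaquetteEdges p →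
        (p.2.1.1 ≠ 0 ∧ p.1 0 = w 0) ∨ p = (w, ⟨(0, μ), hμ'⟩) ∨ p = (w - Pi.single 0 1, ⟨(0, μ), hμ'⟩) := by
      intro p _ hw
      obtain ⟨x, ⟨⟨j, k⟩, hjk⟩⟩ := p
      rcases ClosedFamilies.cases_of_transverse_mem hμ' hw with ⟨h0, hj⟩ | ⟨hj, hk, hx⟩ | ⟨hj, hk, hx⟩
      · exact Or.inl ⟨hj, h0⟩
      · subst hj hk hx
        exact Or.inr (Or.inl rfl)
      · subst hj hk hx
        exact Or.inr (Or.inr rfl)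
    rcases classify h₁ hl₁ with ⟨q₁, t₁⟩ | rfl | rfl <;> rcases classify h₂ hl₂ with ⟨q₂, t₂⟩ | rfl | rfl <;>
      rcases classify h₃ hl₃ with ⟨q₃, t₃⟩ | rfl | rfl
    -- 27 cases: two caps at one time coincide, two equal sides coincide, cap + both sides impossible
    · exact Or.inl (eq_of_nonTemporal_time h₁ h₂ q₁ q₂ (t₁.trans t₂.symm))
    · exact Or.inl (eq_of_nonTemporal_time h₁ h₂ q₁ q₂ (t₁.trans t₂.symm))
    · exact Or.inl (eq_of_nonTemporal_time h₁ h₂ q₁ q₂ (t₁.trans t₂.symm))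
    · exact Or.inr (Or.inl (eq_of_nonTemporal_time h₁ h₃ q₁ q₃ (t₁.trans t₃.symm)))
    · exact Or.inr (Or.inr rfl)
    · exact (not_cap_and_two_sides h₁ q₁ t₁ h₂ h₃).elim
    · exact Or.inr (Or.inl (eq_of_nonTemporal_time h₁ h₃ q₁ q₃ (t₁.trans t₃.symm)))
    · exact (not_cap_and_two_sides h₁ q₁ t₁ h₃ h₂).elim
    · exact Or.inr (Or.inr rfl)
    · exact Or.inr (Or.inr (eq_of_nonTemporal_time h₂ h₃ q₂ q₃ (t₂.trans t₃.symm)))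
    · exact Or.inr (Or.inl rfl)
    · exact (not_cap_and_two_sides h₂ q₂ t₂ h₁ h₃).elim
    · exact Or.inl rfl
    · exact Or.inl rfl
    · exact Or.inl rfl
    · exact (not_cap_and_two_sides h₃ q₃ t₃ h₁ h₂).elim
    · exact Or.inr (Or.inl rfl)
    · exact Or.inr (Or.inr rfl)
    · exact Or.inr (Or.inr (eq_of_nonTemporal_time h₂ h₃ q₂ q₃ (t₂.trans t₃.symm)))
    · exact (not_cap_and_two_sides h₂ q₂ t₂ h₃ h₁).elim
    · exact Or.inr (Or.inl rfl)
    · exact (not_cap_and_two_sides h₃ q₃ t₃ h₂ h₁).elim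
    · exact Or.inr (Or.inr rfl)
    · exact Or.inr (Or.inl rfl)
    · exact Or.inl rfl
    · exact Or.inl rfl
    · exact Or.inl rfl

/-! ### Reachability from the bottom cap -/

/-- Two faces of the tube sharing a bond are adjacent. [folklore] -/
theorem adj_of_shared {p q : ZdPlaquette 4} (hp : p ∈ longTube z n a ha) (hq : q ∈ longTube z n a ha)
    {ℓ : ZdEdge 4} (hℓp : ℓ ∈ plaquetteEdges p) (hℓq : ℓ ∈ plaquetteEdges q) :
    Relation.ReflTransGen (fun p q : ZdPlaquette 4 => p ∈ longTube z n a ha ∧ q ∈ longTube z n a ha ∧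
      ∃ ℓ ∈ plaquetteEdges p, ℓ ∈ plaquetteEdges q) p q :=
  Relation.ReflTransGen.single ⟨hp, hq, ℓ, hℓp, hℓq⟩

/-- The side `(y + e₀; 0, m)` one level up shares the bond `(y + e₀, m)` with the side `(y; 0, m)`. [folklore] -/
theorem far_bond_shared (y : Site 4) {m : Fin 4} (hm : (0 : Fin 4) < m) :
    ((y + Pi.single 0 1, m) : ZdEdge 4) ∈ plaquetteEdges ((y, ⟨(0, m), hm⟩) : ZdPlaquette 4) ∧
      ((y + Pi.single 0 1, m) : ZdEdge 4) ∈ plaquetteEdges ((y + Pi.single 0 1, ⟨(0, m), hm⟩) : ZdPlaquette 4) := by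
  constructor
  · rw [mk_mem_plaquetteEdges_iff]
    exact Or.inr ⟨rfl, Or.inl rfl⟩
  · rw [mk_mem_plaquetteEdges_iff]
    exact Or.inr ⟨rfl, Or.inr rfl⟩

/-- **Every side is reachable from the bottom cap** (level by level along the far bonds). [folklore] -/
theorem reach_sides : ∀ k, k < n → ∀ p ∈ tubeSides (z + Pi.single 0 (k : ℤ)) a ha,
    Relation.ReflTransGen (fun p q : ZdPlaquette 4 => p ∈ longTube z n a ha ∧ q ∈ longTube z n a ha ∧
      ∃ ℓ ∈ plaquetteEdges p, ℓ ∈ plaquetteEdges q) (z, a) p := by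
  have hbot : ((z, a) : ZdPlaquette 4) ∈ longTube z n a ha := mem_longTube.2 (Or.inl rfl)
  intro k
  induction k with
  | zero =>
    intro hk p hp
    have hpT : p ∈ longTube z n a ha := mem_longTube.2 (Or.inr (Or.inr ⟨0, hk, hp⟩))
    rw [mem_tubeSides] at hp
    simp only [Nat.cast_zero, Pi.single_zero, add_zero] at hp
    rcases hp with rfl | rfl | rfl | rfl
    · refine adj_of_shared hbot hpT (ℓ := (z, a.1.1)) ?_ ?_
      · rw [mk_mem_plaquetteEdges_iff]; exact Or.inl ⟨rfl, Or.inl rfl⟩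
      · rw [mk_mem_plaquetteEdges_iff]; exact Or.inr ⟨rfl, Or.inr rfl⟩
    · refine adj_of_shared hbot hpT (ℓ := (z + Pi.single a.1.2 1, a.1.1)) ?_ ?_
      · rw [mk_mem_plaquetteEdges_iff]; exact Or.inl ⟨rfl, Or.inr rfl⟩
      · rw [mk_mem_plaquetteEdges_iff]; exact Or.inr ⟨rfl, Or.inr rfl⟩
    · refine adj_of_shared hbot hpT (ℓ := (z, a.1.2)) ?_ ?_
      · rw [mk_mem_plaquetteEdges_iff]; exact Or.inr ⟨rfl, Or.inr rfl⟩
      · rw [mk_mem_plaquetteEdges_iff]; exact Or.inr ⟨rfl, Or.inr rfl⟩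
    · refine adj_of_shared hbot hpT (ℓ := (z + Pi.single a.1.1 1, a.1.2)) ?_ ?_
      · rw [mk_mem_plaquetteEdges_iff]; exact Or.inr ⟨rfl, Or.inl rfl⟩
      · rw [mk_mem_plaquetteEdges_iff]; exact Or.inr ⟨rfl, Or.inr rfl⟩
  | succ k ih =>
    intro hk p hp
    have hpT : p ∈ longTube z n a ha := mem_longTube.2 (Or.inr (Or.inr ⟨k + 1, hk, hp⟩))
    have ih' := ih (by omega)
    have hlow : ∀ q ∈ tubeSides (z + Pi.single 0 (k : ℤ)) a ha, q ∈ longTube z n a ha := fun q hq =>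
      mem_longTube.2 (Or.inr (Or.inr ⟨k, by omega, hq⟩))
    rw [← level_succ] at hp
    -- each side at level `k+1` hangs on the side below it by the far bond
    have step : ∀ (y : Site 4) (m : Fin 4) (hm : (0 : Fin 4) < m),
        ((y, ⟨(0, m), hm⟩) : ZdPlaquette 4) ∈ tubeSides (z + Pi.single 0 (k : ℤ)) a ha →
        ((y + Pi.single 0 1, ⟨(0, m), hm⟩) : ZdPlaquette 4) ∈ longTube z n a ha →
        Relation.ReflTransGen (fun p q : ZdPlaquette 4 => p ∈ longTube z n a ha ∧ q ∈ longTube z n a ha ∧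
          ∃ ℓ ∈ plaquetteEdges p, ℓ ∈ plaquetteEdges q) (z, a) (y + Pi.single 0 1, ⟨(0, m), hm⟩) := by
      intro y m hm hy hy'
      exact (ih' _ hy).trans (adj_of_shared (hlow _ hy) hy' (far_bond_shared y hm).1 (far_bond_shared y hm).2)
    rw [mem_tubeSides] at hp
    rcases hp with rfl | rfl | rfl | rfl
    · exact step _ _ ha (mem_tubeSides.2 (Or.inl rfl)) hpT
    · rw [add_right_comm] at hpT ⊢
      exact step _ _ ha (mem_tubeSides.2 (Or.inr (Or.inl rfl))) hpT
    · exact step _ _ (ha.trans a.2) (mem_tubeSides.2 (Or.inr (Or.inr (Or.inl rfl)))) hpT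
    · rw [add_right_comm] at hpT ⊢
      exact step _ _ (ha.trans a.2) (mem_tubeSides.2 (Or.inr (Or.inr (Or.inr rfl)))) hpT

/-- **Every face of the tube is reachable from the bottom cap.** [folklore] -/
theorem reach_all (hn : 1 ≤ n) : ∀ p ∈ longTube z n a ha,
    Relation.ReflTransGen (fun p q : ZdPlaquette 4 => p ∈ longTube z n a ha ∧ q ∈ longTube z n a ha ∧
      ∃ ℓ ∈ plaquetteEdges p, ℓ ∈ plaquetteEdges q) (z, a) p := by
  intro p hp
  have hp' := hp
  rw [mem_longTube] at hp
  rcases hp with rfl | rfl | ⟨k, hk, hp⟩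
  · exact Relation.ReflTransGen.refl
  · -- the top cap hangs on the side `(z + (n-1)e₀; 0, a₁)` by the bond `(z + n e₀, a₁)`
    obtain ⟨m, rfl⟩ : ∃ m, n = m + 1 := ⟨n - 1, by omega⟩
    have hs : ((z + Pi.single 0 (m : ℤ), ⟨(0, a.1.1), ha⟩) : ZdPlaquette 4) ∈
        tubeSides (z + Pi.single 0 (m : ℤ)) a ha := mem_tubeSides.2 (Or.inl rfl)
    have hsT : ((z + Pi.single 0 (m : ℤ), ⟨(0, a.1.1), ha⟩) : ZdPlaquette 4) ∈ longTube z (m + 1) a ha :=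
      mem_longTube.2 (Or.inr (Or.inr ⟨m, by omega, hs⟩))
    refine (reach_sides m (by omega) _ hs).trans (adj_of_shared hsT hp' (ℓ := (z + Pi.single 0 ((m + 1 : ℕ) : ℤ), a.1.1)) ?_ ?_)
    · rw [← level_succ]
      exact (far_bond_shared _ ha).1
    · rw [mk_mem_plaquetteEdges_iff]
      exact Or.inl ⟨rfl, Or.inl rfl⟩
  · exact reach_sides k hk p hp

/-- **The tube of any length `n ≥ 1` is sphere-like**: every proper non-empty sub-family has a private bond. [folklore] -/
theorem longTube_sphere (z : Site 4) {n : ℕ} (hn : 1 ≤ n) (a : {q : Fin 4 × Fin 4 // q.1 < q.2})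
    (ha : (0 : Fin 4) < a.1.1) :
    ∀ S ⊆ longTube z n a ha, S.Nonempty → S ≠ longTube z n a ha →
      ∃ p ∈ S, ∃ ℓ ∈ plaquetteEdges p, ∀ p' ∈ S, p' ≠ p → ℓ ∉ plaquetteEdges p' :=
  sphere_of_reachable (longTube z n a ha) (reach_all hn)
    fun _ _ h₁ _ h₂ _ h₃ hl₁ hl₂ hl₃ => longTube_no_three h₁ h₂ h₃ hl₁ hl₂ hl₃

/-- All three tubes are sphere-like (the `hsph` bookkeeping of `pair_jet_of_class_conn`, via `powerset`). [folklore] -/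
theorem longTubes_sphere (z : Site 4) {n : ℕ} (hn : 1 ≤ n) :
    ∀ T ∈ longTubes z n, ∀ S ∈ T.powerset, S.Nonempty → S ≠ T →
      ∃ p ∈ S, ∃ ℓ ∈ plaquetteEdges p, ∀ p' ∈ S, p' ≠ p → ℓ ∉ plaquetteEdges p' := by
  intro T hT S hS hSne hST
  rw [mem_powerset] at hS
  rw [mem_longTubes] at hT
  rcases hT with rfl | rfl | rfl <;> exact longTube_sphere z hn _ _ S hS hSne hST

end Summit.QuantumFields.YangMills.Cruxes.NT.StrongCouplingRung.LongTube
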